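import Summits.BirchSwinnertonDyer.BirchSwinnertonDyer.Theorems.KimAtThreeDeepLowerOfAdditiveBranch
import HarnessLib

/-!
# Route `KimAtThreeKolyvagin` (rung W2), crux `DeepLowerAtThreeOffKatoStratum` (item 19679, §L child
# of `DeepLowerAtThree` 19075), stub `stub_additiveDefect`: the `∂⁽⁰⁾`-bridge and Miller's halves for a
# LATTICE-OPTIMAL datum with ARBITRARY Manin constant (general odd `p`)

Cell `bsd-addord`, seat `bsd-addord-w2-acc3` (PROGRAMME PART 1b, ACCEL-LIST row (3)), item
`stmt-BirchSwinnertonDyer-19679`, stub `stub_additiveDefect` of the registered skeleton (the ADDITIVE-DEFECT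
rows `Addv W₀ 3 ∧ (3 ∣ c₃ ∨ #E(ℚ₃)[3] ≠ 1 ∨ 3 ∣ c_{D₀})` of the off-Kato-stratum complement, in kim3's
optimal-datum-at-conductor currency). TOOL FILE (theorems only: no definition, no named fact, no `sorry`;
nothing asserted, nothing booked; crux and stub stay OPEN); its sequel
`KimAtThreeDeepLowerOffStratumAdditiveDefect` specialises to `p = 3` and to the registered signature.

## What

w2-c2's BSD-currency socket for the parent crux (`KimAtThreeDeepLowerSmallDefect` §3: Miller's lower half
⟹ `∂⁽⁰⁾(δ̃) ≤ ord_p #Ш(p) + v_p(∏ c_ℓ)`) carries the period transfer `Ω(W) = u·Ω⁺_f`, `|u|_p = 1`, which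
an optimal datum supplies ONLY when `p ∤ c_D` (`X4.periodTransfer_of_optimal`) — FALSE on the stub's
sub-row `3 ∣ c_{D₀}`. Here it is removed: for a lattice-optimal datum `D` (`Λ_W = c_D · Λ_{D.f}`) the tree
proves `Ω(W) = |c_D| · Ω⁺_{D.f}` EXACTLY (`X4.realPeriodRat_eq_abs_maninConstant_mul_plusPeriod_of_optimal`,
NO Manin hypothesis), so with `q = L(E,1)/Ω(W)`: `∂⁽⁰⁾(δ̃_{D.f}) = ord_p [0]⁺_{D.f} = ord_p q + v_p(c_D)`
(§1), and Miller's halves read, on a rank-`0` row with `E[p]` irreducible (§2):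

* lower half `MissingLowerBoundAt W p` ⟹ `∂⁽⁰⁾ ≤ ord_p #Ш(p) + v_p(∏ c_ℓ) + v_p(c_D)`;
* upper half `MissingUpperBoundAt W p` ⟹ `ord_p #Ш(p) + v_p(∏ c_ℓ) + v_p(c_D) ≤ ∂⁽⁰⁾`;
* hence crux 19679's conclusion `∃ d, ∂^{(∞)}_{deep} = d ∧ ∂⁽⁰⁾ ≤ ord_p #Ш(p) + d` at the row follows from
  the lower half and ONE displayed divisibility hypothesis
  `v_p(∏ c_ℓ) + v_p(c_D) ≤ ∂^{(∞)}_{deep}(δ̃_{D.f})` — «TAMAGAWA–MANIN DIVISIBILITY OF DEEP KURIHARA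
  NUMBERS» — OUTRIGHT when `p ∤ c_D · ∏ c_ℓ` (the sequel feeds cell n1011's typed `≥` half of Kim's
  Conjecture 1.10 `X4.KimTamagawaDefectGeAt W p D.f` when `p ∤ c_D`); conversely, given the upper half, the
  conclusion FORCES that divisibility, and under `MissingPPartAt W p` (= `BSD(E,p)` in Miller's currency)
  the two are EQUIVALENT (`deepLower_conclusion_optimal_iff_of_missingPPartAt`).

READING. The tree's Kurihara numbers are `Ω⁺_f`-normalised, Kim's `δ̃` is `Ω_E`-normalised (AJM 148
§1.4.3); for the optimal curve `Ω_E = |c_D|·Ω⁺_f`, so `δ̃^{tree}_n = |c_D|·δ̃^{Kim}_n` and every `∂`-functional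
shifts by exactly `v_p(c_D)`: the displayed hypothesis IS Kim's Conjecture 1.10 (`≥` half, deep reading) for
the optimal curve in Kim's own normalisation — the Manin constant is a change of units, not an extra
conjecture. A HYPOTHESIS, never a fact (OPEN at every additive `p`; Kim–Pollack 2025 announce it, PRE).

References: [Kim2022StructureSelmer] §1.4.3, §1.5.1 (PDF p. 7), Conj. 1.10 (PDF p. 8), Thm. 1.9 (6);
[MazurRubin2004] Def. 5.2.11, Thm. 5.2.12; [CremonaAlgorithms1997] §2.8 (p. 26), §2.10;
[EdixhovenManin1991] §1; [Miller2011LMS] Def. 1.1; [MazurTateTeitelbaum1986Invent] §I.8 (8.6).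
-/

set_option autoImplicit false
-- the Theorems namespace of a single-conjunct summit repeats the summit name by design (D-0017)
set_option linter.dupNamespace false

noncomputable section

open scoped MatrixGroups ModularForm Classical

open CongruenceSubgroup WeierstrassCurve Literature.NumberTheory.EllipticCurves
  Literature.NumberTheory.EllipticCurves.ModularForms
  Literature.NumberTheory.EllipticCurves.Rank1Residual
  Literature.NumberTheory.EllipticCurves.Rank1Residual.Typed

namespace Summit.BirchSwinnertonDyer.BirchSwinnertonDyer.Theorems.KimAtThreeDeepLowerOffStratumManinPeriod

open Summit.BirchSwinnertonDyer.Rank1Residual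
open Summit.BirchSwinnertonDyer.Rank1Residual.Additive
open Summit.BirchSwinnertonDyer.Rank1Residual.Supersingular
open Summit.BirchSwinnertonDyer.BirchSwinnertonDyer.Theses.KimAtThreeKolyvagin
open Summit.BirchSwinnertonDyer.BirchSwinnertonDyer.Theorems.KimAtThreeKolyvaginUnitLevelOneRungs
open Summit.BirchSwinnertonDyer.BirchSwinnertonDyer.Theorems.KimAtThreeKolyvaginDeepUpperRung
open Summit.BirchSwinnertonDyer.BirchSwinnertonDyer.Theorems.KimAtThreeKolyvaginCertificateDictionary
open Summit.BirchSwinnertonDyer.BirchSwinnertonDyer.Theorems.KimAtThreeDeepLowerSmallDefect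
open Summit.BirchSwinnertonDyer.BirchSwinnertonDyer.Theorems.KimAtThreeDeepLowerNonAdditiveRows

/-! ### §1 The `∂⁽⁰⁾`-bridge with a period ratio of ARBITRARY valuation (general odd `p`) -/

section Bridge

variable (W : WeierstrassCurve ℚ) [W.IsElliptic] [W.IsGloballyMinimal] (p : ℕ) [Fact p.Prime]
  {N : ℕ} [NeZero N] (f : CuspForm (Gamma0 N) 2)

omit [W.IsGloballyMinimal] in
/-- **`ord_p [0]⁺_f = ord_p(L(E,1)/Ω(W)) + ord_p(Ω(W)/Ω⁺_f)`.** For `f` the newform of `W` with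
`[0]⁺_f ≠ 0`, a period ratio `Ω(W) = u · Ω⁺_f` (`u ∈ ℚˣ`, ANY valuation) and `L(E,1)/Ω(W) = q`:
`q = [0]⁺_f / u` (`L(E,1) = [0]⁺_f · Ω⁺_f`), so `ord_p [0]⁺_f = ord_p q + ord_p u`.
[cite: MazurTateTeitelbaum1986Invent, §I.8 (8.6)] [cite: Kim2022StructureSelmer, §1.4.3 (PDF p. 7)] -/
theorem padicValRat_ratPlusSymbol_zero_eq_add (hf : IsNewformOf W f) (h0 : ratPlusSymbol f 0 ≠ 0)
    {u : ℚ} (hu0 : u ≠ 0) (hΩ : W.realPeriodRat = u * plusPeriod f)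
    {q : ℚ} (hq : W.entireLFunction 1 / (W.realPeriodRat : ℂ) = (q : ℂ)) :
    padicValRat p (ratPlusSymbol f 0) = padicValRat p q + padicValRat p u := by
  have hΩf : 0 < plusPeriod f := IsNewform0.plusPeriod_pos_holds hf.1 hf.coeffField_eq_bot
  have hq' : q = ratPlusSymbol f 0 / u := by
    have hu' : (u : ℂ) ≠ 0 := by exact_mod_cast hu0
    have hΩf' : ((plusPeriod f : ℝ) : ℂ) ≠ 0 := by exact_mod_cast hΩf.ne'
    have h1 : (q : ℂ) = ((ratPlusSymbol f 0 / u : ℚ) : ℂ) := by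
      rw [← hq, hf.entireLFunction_one_eq, hΩ]
      push_cast
      field_simp
    exact_mod_cast h1
  rw [hq', padicValRat.div h0 hu0]
  ring

/-- **`∂⁽⁰⁾(δ̃) = ord_p q + ord_p u` (as a natural number) for a period ratio of arbitrary valuation.**
For odd `p`, `E[p]` irreducible (so `[0]⁺_f` is `p`-integral), `f` the newform of `W` with `[0]⁺_f ≠ 0`,
`Ω(W) = u · Ω⁺_f` and `L(E,1)/Ω(W) = q`: `0 ≤ ord_p q + ord_p u` and
`∂⁽⁰⁾(δ̃) = ord_p [0]⁺_f = ord_p q + ord_p u` (Kim §1.5.1: "`∂⁽⁰⁾(δ̃)` = the `p`-adic valuation of `δ̃₁`";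
`kuriharaDivIndex_one_eq`). The unit case `ord_p u = 0` is the two bridges of
`KimAtThreeKolyvaginDeepUpperRung` / `KimAtThreeKolyvaginDeepLowerOfCertificate`.
[cite: Kim2022StructureSelmer, §1.4.3 and §1.5.1 (PDF p. 7)] [cite: MazurTateTeitelbaum1986Invent, §I.8 (8.6)] -/
theorem kuriharaPartial_zero_eq_of_periodRatio (hp2 : p ≠ 2)
    (hirr : W.HasIrreducibleModPGaloisRep p) (hf : IsNewformOf W f) (h0 : ratPlusSymbol f 0 ≠ 0)
    {u : ℚ} (hu0 : u ≠ 0) (hΩ : W.realPeriodRat = u * plusPeriod f)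
    {q : ℚ} (hq : W.entireLFunction 1 / (W.realPeriodRat : ℂ) = (q : ℂ)) :
    0 ≤ padicValRat p q + padicValRat p u ∧
      kuriharaPartial W p f 0 = ((padicValRat p q + padicValRat p u).toNat : ℕ∞) := by
  have hint0 : ¬ p ∣ (ratPlusSymbol f 0).den :=
    not_dvd_den_of_norm_ratCast_le_one (norm_ratPlusSymbol_le_one_of_irreducible hp2 hf hirr 0)
  have hsum := padicValRat_ratPlusSymbol_zero_eq_add W p f hf h0 hu0 hΩ hq
  refine ⟨?_, ?_⟩
  · rw [← hsum]
    exact padicValRat_ratPlusSymbol_nonneg_of_irreducible hp2 hf hirr 0 h0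
  · rw [kuriharaPartial_zero, kuriharaDivIndex_one_eq W p f hint0 h0, hsum]

/-- **BSD currency ⇒ `∂`-currency, `≤` direction, arbitrary period ratio**: `ord_p q + ord_p u ≤ m ⟹
∂⁽⁰⁾(δ̃) ≤ m`. [cite: Kim2022StructureSelmer, §1.5.1 (PDF p. 7)] -/
theorem kuriharaPartial_zero_le_natCast_of_padicValRat_add_le (hp2 : p ≠ 2)
    (hirr : W.HasIrreducibleModPGaloisRep p) (hf : IsNewformOf W f) (h0 : ratPlusSymbol f 0 ≠ 0)
    {u : ℚ} (hu0 : u ≠ 0) (hΩ : W.realPeriodRat = u * plusPeriod f)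
    {q : ℚ} (hq : W.entireLFunction 1 / (W.realPeriodRat : ℂ) = (q : ℂ)) {m : ℕ}
    (hm : padicValRat p q + padicValRat p u ≤ (m : ℤ)) : kuriharaPartial W p f 0 ≤ (m : ℕ∞) := by
  obtain ⟨-, h⟩ := kuriharaPartial_zero_eq_of_periodRatio W p f hp2 hirr hf h0 hu0 hΩ hq
  rw [h]
  have hnat : (padicValRat p q + padicValRat p u).toNat ≤ m := by omega
  exact_mod_cast hnat

/-- **BSD currency ⇒ `∂`-currency, `≥` direction, arbitrary period ratio**: `m ≤ ord_p q + ord_p u ⟹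
m ≤ ∂⁽⁰⁾(δ̃)`. [cite: Kim2022StructureSelmer, §1.5.1 (PDF p. 7)] -/
theorem natCast_le_kuriharaPartial_zero_of_le_padicValRat_add (hp2 : p ≠ 2)
    (hirr : W.HasIrreducibleModPGaloisRep p) (hf : IsNewformOf W f) (h0 : ratPlusSymbol f 0 ≠ 0)
    {u : ℚ} (hu0 : u ≠ 0) (hΩ : W.realPeriodRat = u * plusPeriod f)
    {q : ℚ} (hq : W.entireLFunction 1 / (W.realPeriodRat : ℂ) = (q : ℂ)) {m : ℕ}
    (hm : (m : ℤ) ≤ padicValRat p q + padicValRat p u) : (m : ℕ∞) ≤ kuriharaPartial W p f 0 := by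
  obtain ⟨-, h⟩ := kuriharaPartial_zero_eq_of_periodRatio W p f hp2 hirr hf h0 hu0 hΩ hq
  rw [h]
  have hnat : m ≤ (padicValRat p q + padicValRat p u).toNat := by omega
  exact_mod_cast hnat

end Bridge

/-! ### §2 A lattice-optimal datum with arbitrary Manin constant: Miller's halves in `∂`-currency -/

section Optimal

variable (W : WeierstrassCurve ℚ) [W.IsElliptic] [W.IsGloballyMinimal] (p : ℕ) [Fact p.Prime]
  {N : ℕ} [NeZero N] (D : ModularParametrizationData W N)

omit [W.IsGloballyMinimal] [Fact p.Prime] in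
/-- **`Ω(W) = |c_D| · Ω⁺_{D.f}` in the rational-ratio shape of §1** (the tree theorem
`X4.realPeriodRat_eq_abs_maninConstant_mul_plusPeriod_of_optimal` for a LATTICE-OPTIMAL datum
`Λ_W = c_D · Λ_{D.f}`; no hypothesis on `c_D`). [cite: CremonaAlgorithms1997, §2.8 (p. 26) and §2.10]
[cite: EdixhovenManin1991, §1] -/
theorem realPeriodRat_eq_ratCast_abs_maninConstant_mul_plusPeriod
    (hopt : ∀ z ∈ D.L.lattice, ∃ w ∈ periodLattice D.f, z = D.c * w) :
    W.realPeriodRat = (((|D.maninConstant| : ℤ) : ℚ) : ℝ) * plusPeriod D.f := by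
  rw [X4.realPeriodRat_eq_abs_maninConstant_mul_plusPeriod_of_optimal D hopt]
  push_cast
  rfl

omit [W.IsElliptic] [W.IsGloballyMinimal] [Fact p.Prime] in
/-- `ord_p |c_D| = v_p(c_D)` (`padicValInt`). [folklore] -/
theorem padicValRat_abs_maninConstant :
    padicValRat p (((|D.maninConstant| : ℤ) : ℚ)) = (padicValInt p D.maninConstant : ℤ) := by
  rw [padicValRat.of_int]
  simp only [padicValInt, Int.natAbs_abs]

omit [W.IsElliptic] [W.IsGloballyMinimal] [Fact p.Prime] in
/-- `|c_D| ≠ 0` as a rational (`c_D ≠ 0`, `maninConstant_ne_zero_holds`). [cite: EdixhovenManin1991, §1] -/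
theorem ratCast_abs_maninConstant_ne_zero : (((|D.maninConstant| : ℤ) : ℚ)) ≠ 0 := by
  exact_mod_cast abs_ne_zero.mpr D.maninConstant_ne_zero_holds

/-- **`∂⁽⁰⁾(δ̃_{D.f}) = ord_p(L(E,1)/Ω(W)) + v_p(c_D)` for a lattice-optimal datum.** Odd `p`, `E[p]`
irreducible, `ord(δ̃) = 0`; `q = L(E,1)/Ω(W)`. [cite: Kim2022StructureSelmer, §1.4.3 and §1.5.1 (PDF p. 7)]
[cite: CremonaAlgorithms1997, §2.8 (p. 26)] -/
theorem kuriharaPartial_zero_eq_padicValRat_add_manin_of_optimal (hp2 : p ≠ 2)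
    (hirr : W.HasIrreducibleModPGaloisRep p)
    (hopt : ∀ z ∈ D.L.lattice, ∃ w ∈ periodLattice D.f, z = D.c * w)
    (hord : kuriharaVanishingOrder W p D.f = 0)
    {q : ℚ} (hq : W.entireLFunction 1 / (W.realPeriodRat : ℂ) = (q : ℂ)) :
    0 ≤ padicValRat p q + padicValInt p D.maninConstant ∧
      kuriharaPartial W p D.f 0 = ((padicValRat p q + padicValInt p D.maninConstant).toNat : ℕ∞) := by
  have h := kuriharaPartial_zero_eq_of_periodRatio W p D.f hp2 hirr D.isNewformOf
    (ratPlusSymbol_zero_ne_zero_of_kuriharaVanishingOrder_eq_zero W p D.f hord)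
    (ratCast_abs_maninConstant_ne_zero W D) (realPeriodRat_eq_ratCast_abs_maninConstant_mul_plusPeriod W D hopt) hq
  rwa [padicValRat_abs_maninConstant W p D] at h

omit [W.IsGloballyMinimal] in
/-- The rational `L(E,1)/Ω(W)` of a lattice-optimal datum: `[0]⁺_{D.f} / |c_D|`.
[cite: MazurTateTeitelbaum1986Invent, §I.8 (8.6)] [cite: CremonaAlgorithms1997, §2.8 (p. 26)] -/
theorem entireLFunction_one_div_realPeriodRat_eq_of_optimal
    (hopt : ∀ z ∈ D.L.lattice, ∃ w ∈ periodLattice D.f, z = D.c * w) :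
    W.entireLFunction 1 / (W.realPeriodRat : ℂ) =
      ((ratPlusSymbol D.f 0 / (((|D.maninConstant| : ℤ) : ℚ)) : ℚ) : ℂ) := by
  have hf : IsNewformOf W D.f := D.isNewformOf
  have hΩf : 0 < plusPeriod D.f := IsNewform0.plusPeriod_pos_holds hf.1 hf.coeffField_eq_bot
  have hΩf' : ((plusPeriod D.f : ℝ) : ℂ) ≠ 0 := by exact_mod_cast hΩf.ne'
  -- with the ratio `u` generalised, so that the casts on both sides normalise alike
  have key : ∀ u : ℚ, u ≠ 0 → W.realPeriodRat = u * plusPeriod D.f →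
      W.entireLFunction 1 / (W.realPeriodRat : ℂ) = ((ratPlusSymbol D.f 0 / u : ℚ) : ℂ) := by
    intro u hu0 hΩ
    have hu' : (u : ℂ) ≠ 0 := by exact_mod_cast hu0
    rw [hf.entireLFunction_one_eq, hΩ]
    push_cast
    field_simp
  exact key _ (ratCast_abs_maninConstant_ne_zero W D)
    (realPeriodRat_eq_ratCast_abs_maninConstant_mul_plusPeriod W D hopt)

/-- **Miller's LOWER half ⟹ `∂⁽⁰⁾ ≤ ord_p #Ш(E/ℚ)(p) + v_p(∏ c_ℓ) + v_p(c_D)`** for a lattice-optimal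
datum `D` of a globally minimal `W/ℚ`, odd `p`, `E[p]` irreducible (`p ∤ #E(ℚ)_tors`), `ord(δ̃_{D.f}) = 0`
(analytic rank `0`), granted GZK (`Ш` finite, rank `0`): `#Ш_an = q · #tors² / ∏ c_ℓ` with
`q = L(E,1)/Ω(W)`, `ord_p q ≤ ord_p #Ш + v_p(∏ c_ℓ)`, and `∂⁽⁰⁾ = ord_p q + v_p(c_D)`. The unit-transfer
case is w2-c2's `kuriharaPartial_zero_le_sha_add_tamagawa_of_missingLowerBoundAt`. [cite: Miller2011LMS, Def. 1.1]
[cite: Kim2022StructureSelmer, §1.5.1 (PDF p. 7)] [cite: CremonaAlgorithms1997, §2.8 (p. 26)] -/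
theorem kuriharaPartial_zero_le_sha_add_tamagawa_add_manin_of_missingLowerBoundAt
    (hGZK : rank_eq_analyticRank_of_analyticRank_le_one) (hp2 : p ≠ 2)
    (hirr : W.HasIrreducibleModPGaloisRep p)
    (hopt : ∀ z ∈ D.L.lattice, ∃ w ∈ periodLattice D.f, z = D.c * w)
    (hord : kuriharaVanishingOrder W p D.f = 0) (hlow : MissingLowerBoundAt W p) :
    kuriharaPartial W p D.f 0 ≤
      ((padicValNat p (Nat.card (AddCommGroup.primaryComponent W.sha p)) +
        padicValNat p W.tamagawaProduct + padicValInt p D.maninConstant : ℕ) : ℕ∞) := by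
  have hf : IsNewformOf W D.f := D.isNewformOf
  have h0 : ratPlusSymbol D.f 0 ≠ 0 :=
    ratPlusSymbol_zero_ne_zero_of_kuriharaVanishingOrder_eq_zero W p D.f hord
  have hL : W.entireLFunction 1 ≠ 0 := hf.entireLFunction_one_ne_zero_of_ratPlusSymbol_zero_ne_zero h0
  have hr0 : W.analyticRank = 0 := analyticRank_eq_zero_of_entireLFunction_one_ne_zero hL
  obtain ⟨-, hfin⟩ := hGZK W (by rw [hr0]; exact zero_le_one)
  haveI : Finite W.sha := hfin
  have hq := entireLFunction_one_div_realPeriodRat_eq_of_optimal W D hopt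
  have hq0 : ratPlusSymbol D.f 0 / (((|D.maninConstant| : ℤ) : ℚ)) ≠ 0 :=
    div_ne_zero h0 (ratCast_abs_maninConstant_ne_zero W D)
  -- Miller's rational IS `q · #tors² / ∏ c_ℓ`
  obtain ⟨q', hq', hv⟩ := hlow
  have hqq : q' = ratPlusSymbol D.f 0 / (((|D.maninConstant| : ℤ) : ℚ)) * (W.torsionOrder : ℚ) ^ 2 /
      (W.tamagawaProduct : ℚ) := by
    have h1 := hq'.symm.trans (shaAn_eq_of_analyticRank_eq_zero W hGZK hr0 hq)
    exact_mod_cast h1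
  have hsha : padicValNat p (Nat.card (AddCommGroup.primaryComponent W.sha p)) =
      padicValNat p W.shaOrder := by
    unfold WeierstrassCurve.shaOrder
    exact padicValNat_card_addPrimaryComponent p
  rw [hqq, padicValRat_shaAn_witness W p hirr hq0, ← hsha] at hv
  obtain ⟨-, heq⟩ := kuriharaPartial_zero_eq_padicValRat_add_manin_of_optimal W p D hp2 hirr hopt hord hq
  rw [heq]
  have hv' : padicValRat p (ratPlusSymbol D.f 0 / (((|D.maninConstant| : ℤ) : ℚ))) ≤
      (padicValNat p (Nat.card (AddCommGroup.primaryComponent W.sha p)) : ℤ) +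
        (padicValNat p W.tamagawaProduct : ℤ) := by
    linarith
  have hnat : (padicValRat p (ratPlusSymbol D.f 0 / (((|D.maninConstant| : ℤ) : ℚ))) +
      (padicValInt p D.maninConstant : ℤ)).toNat ≤
      padicValNat p (Nat.card (AddCommGroup.primaryComponent W.sha p)) +
        padicValNat p W.tamagawaProduct + padicValInt p D.maninConstant := by
    omega
  exact_mod_cast hnat

/-- **Miller's UPPER half ⟹ `ord_p #Ш(E/ℚ)(p) + v_p(∏ c_ℓ) + v_p(c_D) ≤ ∂⁽⁰⁾`** (same row; converse
companion). With w2-c3's / w2-c4's unit-transfer versions this says: the Manin exponent enters BOTH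
halves with the same sign — it is a change of normalisation, not a defect. [cite: Miller2011LMS, Def. 1.1]
[cite: Kim2022StructureSelmer, §1.5.1 (PDF p. 7)] [cite: CremonaAlgorithms1997, §2.8 (p. 26)] -/
theorem sha_add_tamagawa_add_manin_le_kuriharaPartial_zero_of_missingUpperBoundAt
    (hGZK : rank_eq_analyticRank_of_analyticRank_le_one) (hp2 : p ≠ 2)
    (hirr : W.HasIrreducibleModPGaloisRep p)
    (hopt : ∀ z ∈ D.L.lattice, ∃ w ∈ periodLattice D.f, z = D.c * w)
    (hord : kuriharaVanishingOrder W p D.f = 0) (hup : MissingUpperBoundAt W p) :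
    ((padicValNat p (Nat.card (AddCommGroup.primaryComponent W.sha p)) +
        padicValNat p W.tamagawaProduct + padicValInt p D.maninConstant : ℕ) : ℕ∞) ≤
      kuriharaPartial W p D.f 0 := by
  have hf : IsNewformOf W D.f := D.isNewformOf
  have h0 : ratPlusSymbol D.f 0 ≠ 0 :=
    ratPlusSymbol_zero_ne_zero_of_kuriharaVanishingOrder_eq_zero W p D.f hord
  have hL : W.entireLFunction 1 ≠ 0 := hf.entireLFunction_one_ne_zero_of_ratPlusSymbol_zero_ne_zero h0
  have hr0 : W.analyticRank = 0 := analyticRank_eq_zero_of_entireLFunction_one_ne_zero hL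
  obtain ⟨-, hfin⟩ := hGZK W (by rw [hr0]; exact zero_le_one)
  haveI : Finite W.sha := hfin
  have hq := entireLFunction_one_div_realPeriodRat_eq_of_optimal W D hopt
  have hq0 : ratPlusSymbol D.f 0 / (((|D.maninConstant| : ℤ) : ℚ)) ≠ 0 :=
    div_ne_zero h0 (ratCast_abs_maninConstant_ne_zero W D)
  obtain ⟨q', hq', hv⟩ := hup
  have hqq : q' = ratPlusSymbol D.f 0 / (((|D.maninConstant| : ℤ) : ℚ)) * (W.torsionOrder : ℚ) ^ 2 /
      (W.tamagawaProduct : ℚ) := by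
    have h1 := hq'.symm.trans (shaAn_eq_of_analyticRank_eq_zero W hGZK hr0 hq)
    exact_mod_cast h1
  have hsha : padicValNat p (Nat.card (AddCommGroup.primaryComponent W.sha p)) =
      padicValNat p W.shaOrder := by
    unfold WeierstrassCurve.shaOrder
    exact padicValNat_card_addPrimaryComponent p
  rw [hqq, padicValRat_shaAn_witness W p hirr hq0, ← hsha] at hv
  obtain ⟨-, heq⟩ := kuriharaPartial_zero_eq_padicValRat_add_manin_of_optimal W p D hp2 hirr hopt hord hq
  rw [heq]
  have hv' : (padicValNat p (Nat.card (AddCommGroup.primaryComponent W.sha p)) : ℤ) +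
        (padicValNat p W.tamagawaProduct : ℤ) ≤
      padicValRat p (ratPlusSymbol D.f 0 / (((|D.maninConstant| : ℤ) : ℚ))) := by
    linarith
  have hnat : padicValNat p (Nat.card (AddCommGroup.primaryComponent W.sha p)) +
        padicValNat p W.tamagawaProduct + padicValInt p D.maninConstant ≤
      (padicValRat p (ratPlusSymbol D.f 0 / (((|D.maninConstant| : ℤ) : ℚ))) +
        (padicValInt p D.maninConstant : ℤ)).toNat := by
    omega
  exact_mod_cast hnat

/-- **Lower half ∧ «Tamagawa–Manin divisibility of deep Kurihara numbers» ⟹ crux 19679's conclusion at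
the row** (the LOWER inequality `∃ d, ∂^{(∞)}_{deep} = d ∧ ∂⁽⁰⁾ ≤ ord_p #Ш(p) + d` for `(W, D.f)`): the
lower half gives `∂⁽⁰⁾ ≤ s + (v_p(∏ c_ℓ) + v_p(c_D))` and the displayed divisibility
`v_p(∏ c_ℓ) + v_p(c_D) ≤ ∂^{(∞)}_{deep}(δ̃_{D.f})` — Kim's Conjecture 1.10 (`≥` half, deep reading) for the
optimal curve in Kim's `Ω_E`-normalisation — closes it (w2-c2's `deepLower_conclusion_of_le_add_of_le_deepInfty`).
A HYPOTHESIS, not a fact. [cite: Kim2022StructureSelmer, Conj. 1.10 (PDF p. 8), Thm. 1.9 (6)]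
[cite: MazurRubin2004, Def. 5.2.11, Thm. 5.2.12] [cite: Miller2011LMS, Def. 1.1] -/
theorem deepLower_conclusion_optimal_of_missingLowerBoundAt_of_tamagawaManin_le_deepInfty
    (hGZK : rank_eq_analyticRank_of_analyticRank_le_one) (hp2 : p ≠ 2)
    (hirr : W.HasIrreducibleModPGaloisRep p)
    (hopt : ∀ z ∈ D.L.lattice, ∃ w ∈ periodLattice D.f, z = D.c * w)
    (hord : kuriharaVanishingOrder W p D.f = 0) (hlow : MissingLowerBoundAt W p)
    (hdiv : ((padicValNat p W.tamagawaProduct + padicValInt p D.maninConstant : ℕ) : ℕ∞) ≤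
      kuriharaPartialDeepInfty W p D.f) :
    ∃ d : ℕ, kuriharaPartialDeepInfty W p D.f = d ∧
      kuriharaPartial W p D.f 0 ≤
        ((padicValNat p (Nat.card (AddCommGroup.primaryComponent W.sha p)) + d : ℕ) : ℕ∞) := by
  refine deepLower_conclusion_of_le_add_of_le_deepInfty W p D.f hord
    (e := padicValNat p W.tamagawaProduct + padicValInt p D.maninConstant) ?_ hdiv
  rw [← Nat.add_assoc]
  exact kuriharaPartial_zero_le_sha_add_tamagawa_add_manin_of_missingLowerBoundAt W p D hGZK hp2 hirr
    hopt hord hlow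

/-- **… OUTRIGHT from the lower half when `p ∤ ∏ c_ℓ` and `p ∤ c_D`** (no divisibility input: the rows
of the stub with `#E(ℚ_p)[p] ≠ 1` only — local torsion does not enter the BSD-currency socket, since
`E(ℚ)[p] = 0` under irreducibility). [cite: Miller2011LMS, Def. 1.1] [cite: Kim2022StructureSelmer, Thm. 1.9 (6)] -/
theorem deepLower_conclusion_optimal_of_missingLowerBoundAt_of_not_dvd
    (hGZK : rank_eq_analyticRank_of_analyticRank_le_one) (hp2 : p ≠ 2)
    (hirr : W.HasIrreducibleModPGaloisRep p)
    (hopt : ∀ z ∈ D.L.lattice, ∃ w ∈ periodLattice D.f, z = D.c * w)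
    (hord : kuriharaVanishingOrder W p D.f = 0) (hlow : MissingLowerBoundAt W p)
    (htam : ¬ p ∣ W.tamagawaProduct) (hc : ¬ (p : ℤ) ∣ D.maninConstant) :
    ∃ d : ℕ, kuriharaPartialDeepInfty W p D.f = d ∧
      kuriharaPartial W p D.f 0 ≤
        ((padicValNat p (Nat.card (AddCommGroup.primaryComponent W.sha p)) + d : ℕ) : ℕ∞) := by
  refine deepLower_conclusion_optimal_of_missingLowerBoundAt_of_tamagawaManin_le_deepInfty W p D hGZK
    hp2 hirr hopt hord hlow ?_
  rw [padicValNat.eq_zero_of_not_dvd htam, padicValInt.eq_zero_of_not_dvd hc, Nat.add_zero,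
    Nat.cast_zero]
  exact zero_le

/-- **NECESSITY: given the UPPER half, crux 19679's conclusion at the row FORCES the Tamagawa–Manin
divisibility** (`s + v_p(∏ c_ℓ) + v_p(c_D) ≤ ∂⁽⁰⁾ ≤ s + ∂^{(∞)}_{deep}`). So on every row where Miller's
upper half is a kernel theorem (Kato 2004 Thm. 14.5 at potentially good `3`; cell n1011) the displayed
divisibility is not a convenience but the exact content of the stub. [cite: Kim2022StructureSelmer, Conj. 1.10 (PDF p. 8)]
[cite: Miller2011LMS, Def. 1.1] -/
theorem tamagawaManin_le_deepInfty_of_deepLower_conclusion_of_missingUpperBoundAt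
    (hGZK : rank_eq_analyticRank_of_analyticRank_le_one) (hp2 : p ≠ 2)
    (hirr : W.HasIrreducibleModPGaloisRep p)
    (hopt : ∀ z ∈ D.L.lattice, ∃ w ∈ periodLattice D.f, z = D.c * w)
    (hord : kuriharaVanishingOrder W p D.f = 0) (hup : MissingUpperBoundAt W p)
    (h : ∃ d : ℕ, kuriharaPartialDeepInfty W p D.f = d ∧
      kuriharaPartial W p D.f 0 ≤
        ((padicValNat p (Nat.card (AddCommGroup.primaryComponent W.sha p)) + d : ℕ) : ℕ∞)) :
    ((padicValNat p W.tamagawaProduct + padicValInt p D.maninConstant : ℕ) : ℕ∞) ≤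
      kuriharaPartialDeepInfty W p D.f := by
  obtain ⟨d, hd, hle⟩ := h
  have hge := sha_add_tamagawa_add_manin_le_kuriharaPartial_zero_of_missingUpperBoundAt W p D hGZK hp2
    hirr hopt hord hup
  have h' : padicValNat p (Nat.card (AddCommGroup.primaryComponent W.sha p)) +
        padicValNat p W.tamagawaProduct + padicValInt p D.maninConstant ≤
      padicValNat p (Nat.card (AddCommGroup.primaryComponent W.sha p)) + d := by
    exact_mod_cast hge.trans hle
  rw [hd]
  exact_mod_cast (show padicValNat p W.tamagawaProduct + padicValInt p D.maninConstant ≤ d by omega)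

/-- **Under `BSD(E,p)` in Miller's currency (`MissingPPartAt W p`, both halves) crux 19679's conclusion
at an optimal-datum row ⟺ the Tamagawa–Manin divisibility of deep Kurihara numbers.** Reading for the
planner: at such a row the LOWER twin 19679 is EXACTLY Kim's Conjecture 1.10 (`≥`, deep) for the optimal
curve — neither weaker nor stronger. [cite: Kim2022StructureSelmer, Conj. 1.10 (PDF p. 8), Thm. 1.9 (6)]
[cite: Miller2011LMS, Def. 1.1] -/
theorem deepLower_conclusion_optimal_iff_of_missingPPartAt
    (hGZK : rank_eq_analyticRank_of_analyticRank_le_one) (hp2 : p ≠ 2)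
    (hirr : W.HasIrreducibleModPGaloisRep p)
    (hopt : ∀ z ∈ D.L.lattice, ∃ w ∈ periodLattice D.f, z = D.c * w)
    (hord : kuriharaVanishingOrder W p D.f = 0) (hbsd : MissingPPartAt W p) :
    (∃ d : ℕ, kuriharaPartialDeepInfty W p D.f = d ∧
      kuriharaPartial W p D.f 0 ≤
        ((padicValNat p (Nat.card (AddCommGroup.primaryComponent W.sha p)) + d : ℕ) : ℕ∞)) ↔
    ((padicValNat p W.tamagawaProduct + padicValInt p D.maninConstant : ℕ) : ℕ∞) ≤
      kuriharaPartialDeepInfty W p D.f :=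
  ⟨tamagawaManin_le_deepInfty_of_deepLower_conclusion_of_missingUpperBoundAt W p D hGZK hp2 hirr hopt
      hord (lower_and_upper_of_missingPPartAt W p hbsd).2,
    deepLower_conclusion_optimal_of_missingLowerBoundAt_of_tamagawaManin_le_deepInfty W p D hGZK hp2 hirr
      hopt hord (lower_and_upper_of_missingPPartAt W p hbsd).1⟩

end Optimal

end Summit.BirchSwinnertonDyer.BirchSwinnertonDyer.Theorems.KimAtThreeDeepLowerOffStratumManinPeriod

end
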